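import Literature.NumberTheory.EllipticCurves.Wuthrich2014.ReducibleDivisibility
import Literature.NumberTheory.EllipticCurves.BSDRootNumberSmallConductorProofs
import Literature.NumberTheory.EllipticCurves.ComplexMultiplicationBSDTripleIsogenyProofs
import Literature.NumberTheory.EllipticCurves.ComplexMultiplicationBurungaleFlachProofs
import Literature.NumberTheory.EllipticCurves.MordellWeilRankZeroProofs
import Literature.NumberTheory.EllipticCurves.TamagawaFiniteIndexProofs
import Literature.NumberTheory.EllipticCurves.IsogenyDualProofs
import HarnessLib

/-!
# Wuthrich 2014, Prop. 21 ⟹ `ord_p #Ш ≤ ord_p #Ш_an` and `BSD(E,p)` when `p ∤ #Ш_an`; isogeny transport of `BSD(E,p)`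

`Proofs` companion (theorems only; no new definition, no new named fact) of
`Literature.NumberTheory.EllipticCurves.Wuthrich2014.ReducibleDivisibility` (the named fact
`sha_dvd_analyticSha` = C. Wuthrich, Doc. Math. 19 (2014), Prop. 21) in the vocabulary of Miller's
`BSD(E,p)` (`Literature.NumberTheory.EllipticCurves.BSDp`, `shaAn`, file
`BSDRootNumberSmallConductorProofs`). Written for the BSD rank-`≤ 1` residual census (classes X1/X2,
rank `0`, "lever L1"): every statement below takes its published inputs BY NAME —
`sha_dvd_analyticSha` (Wuthrich 2014, Prop. 21), `rank_eq_analyticRank_of_analyticRank_le_one`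
(Gross–Zagier 1986 + Kolyvagin 1990, bsd.S17), `WeierstrassCurve.bsdRHS_eq_of_isIsogenous` (Cassels
1965 / Milne *ADT* I.7.3) — and everything else is proved in the tree (Faltings/Knapp 11.67
`entireLFunction_eq_of_isIsogenous'`, `tamagawaProduct_pos_holds`, `regulator_eq_one_of_rank_zero`,
`finite_point_of_rank_zero`, …).

* `padicValNat_shaOrder_le_of_sha_dvd` — at an odd prime `p`, not additive, with `ρ̄_{E,p}` reducible
  or surjective, and `L(E,1) ≠ 0`: `ord_p #Ш(E/ℚ) ≤ ord_p((L(E,1)/Ω_E) · #E(ℚ)²/∏ c_ℓ)`;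
* `shaAn_eq_of_L_one_div_eq` — in analytic rank `0`, `#Ш_an = (L(E,1)/Ω_E) · #E(ℚ)²/∏ c_ℓ`;
* `bsdp_of_L_one_ne_zero_of_padicValRat_shaAn_eq_zero` — **`p ∤ #Ш_an ⟹ BSD(E,p)`** under the
  hypotheses of the first item (the one-sided bound pinches `ord_p #Ш` to `0`);
* `shaAn_mul_bsdRHS`, `bsdp_of_isIsogenous` — `#Ш_an · bsdRHS = (L^{(r)}(E,1)/r!) · #Ш`, and
  **`BSD(E',p) ⟹ BSD(E,p)` for `ℚ`-isogenous `E ∼ E'`** granted Cassels' invariance of the BSD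
  quotient (isogeny invariance of `BSD(E,p)`, Miller 2011 §1).

References: C. Wuthrich, Doc. Math. 19 (2014) 381–402, Prop. 21 [Wuthrich2014]; R. L. Miller,
LMS J. Comput. Math. 14 (2011), §1 and Def. 1.1 [Miller2011LMS]; J. S. Milne, *Arithmetic Duality
Theorems*, Thm. I.7.3 [MilneADT2006]; J. W. S. Cassels, J. reine angew. Math. 217 (1965)
[Cassels1965ArithmeticVIII].
-/

set_option autoImplicit false

noncomputable section

open scoped Classical

open WeierstrassCurve Literature.NumberTheory.EllipticCurves

namespace Literature.NumberTheory.EllipticCurves.Wuthrich2014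

/-- **One-sided bound (Wuthrich 2014, Prop. 21): `ord_p #Ш(E/ℚ) ≤ ord_p #Ш(E/ℚ)_an`** at an odd
prime `p` which is not of additive reduction and at which `ρ̄_{E,p}` is reducible or surjective,
for `E/ℚ` with `L(E,1) ≠ 0` (globally minimal `W`; `E(ℚ)` and `Ш(E/ℚ)` finite). Here
`#Ш_an = (L(E,1)/Ω_E) · #E(ℚ)² / ∏ c_ℓ` with `L(E,1)/Ω_E = q ∈ ℚ`. [cite: Wuthrich2014, Prop. 21 (p. 400)] -/
theorem padicValNat_shaOrder_le_of_sha_dvd (hW : sha_dvd_analyticSha)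
    (W : WeierstrassCurve ℚ) [W.IsElliptic] [W.IsGloballyMinimal] (p : ℕ) [Fact p.Prime]
    (hp : p ≠ 2) (hL : W.entireLFunction 1 ≠ 0) (hE : Finite W.toAffine.Point)
    (hsha : Finite W.sha)
    (hadd : ¬ ((W.baseChange ℚ_[p]).minimal ℤ_[p]).HasAdditiveReduction ℤ_[p])
    (himg : ¬ W.HasIrreducibleModPGaloisRep p ∨ W.HasSurjectiveModNGaloisRep p) :
    ∃ q : ℚ, W.entireLFunction 1 / (W.realPeriodRat : ℂ) = (q : ℂ) ∧ q ≠ 0 ∧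
      (padicValNat p W.shaOrder : ℤ) ≤
        padicValRat p (q * (Nat.card W.toAffine.Point : ℚ) ^ 2 / (W.tamagawaProduct : ℚ)) := by
  obtain ⟨q, C, m, hq, hC0, hsupp, hdiv⟩ := hW W hL hE hsha
  -- `q ≠ 0` since `L(E,1) ≠ 0` and `Ω_E > 0`
  have hΩ : (W.realPeriodRat : ℂ) ≠ 0 := by exact_mod_cast W.realPeriodRat_pos_holds.ne'
  have hq0 : q ≠ 0 := by
    rintro rfl
    apply hL
    have h := hq
    rw [Rat.cast_zero, div_eq_zero_iff] at h
    exact h.resolve_right hΩ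
  -- `ord_p C = 0`
  have hvC : padicValRat p C = 0 := by
    by_contra h
    rcases hsupp p h with h2 | hA | ⟨hns, hirr⟩
    · exact hp h2
    · exact hadd hA
    · rcases himg with hred | hsurj
      · exact hred hirr
      · exact hns hsurj
  -- the positive quantities
  have hcard : (Nat.card W.toAffine.Point : ℚ) ≠ 0 := by
    haveI := hE
    exact_mod_cast (Nat.card_pos (α := W.toAffine.Point)).ne'
  have htam : (W.tamagawaProduct : ℚ) ≠ 0 := by
    exact_mod_cast (W.tamagawaProduct_pos_holds : 0 < W.tamagawaProduct).ne'
  have hshapos : (W.shaOrder : ℚ) ≠ 0 := by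
    exact_mod_cast (W.shaOrder_pos hsha).ne'
  set X : ℚ := q * (Nat.card W.toAffine.Point : ℚ) ^ 2 / (W.tamagawaProduct : ℚ) with hX
  have hX0 : X ≠ 0 := by
    rw [hX]
    exact div_ne_zero (mul_ne_zero hq0 (pow_ne_zero 2 hcard)) htam
  have hCX : C * X = (m : ℚ) * (W.shaOrder : ℚ) := by
    rw [hX, ← hdiv]
    ring
  have hm0 : (m : ℚ) ≠ 0 := by
    intro h
    rw [h, zero_mul] at hCX
    exact mul_ne_zero hC0 hX0 hCX
  refine ⟨q, hq, hq0, ?_⟩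
  -- valuations: `v(C) + v(X) = v(m) + v(#Ш)`, `v(C) = 0`, `v(m) ≥ 0`
  have hval := congrArg (padicValRat p) hCX
  rw [padicValRat.mul hC0 hX0, padicValRat.mul hm0 hshapos, hvC, zero_add] at hval
  have hm_nonneg : 0 ≤ padicValRat p (m : ℚ) := by
    rw [padicValRat.of_int]
    exact_mod_cast Nat.zero_le _
  have hsha_val : padicValRat p (W.shaOrder : ℚ) = (padicValNat p W.shaOrder : ℤ) :=
    padicValRat.of_nat
  rw [← hX, hval, ← hsha_val]
  linarith


/-- For `E/ℚ` with `L(E,1) ≠ 0` (globally minimal `W`), Miller's analytic order of `Ш` is the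
rational number `#Ш_an = (L(E,1)/Ω_E) · #E(ℚ)² / ∏ c_ℓ` (`r_an = 0`, `Reg = 1`, `E(ℚ) = E(ℚ)_tors`
by Gross–Zagier–Kolyvagin, the fact `rank_eq_analyticRank_of_analyticRank_le_one`).
[cite: Miller2011LMS, §1 (arXiv:1010.2431 p. 3)] -/
theorem shaAn_eq_of_L_one_div_eq (hGZK : rank_eq_analyticRank_of_analyticRank_le_one)
    (W : WeierstrassCurve ℚ) [W.IsElliptic] [W.IsGloballyMinimal]
    (hL : W.entireLFunction 1 ≠ 0) {q : ℚ}
    (hq : W.entireLFunction 1 / (W.realPeriodRat : ℂ) = (q : ℂ)) :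
    W.mordellWeilRank = 0 ∧ Finite W.toAffine.Point ∧ Finite W.sha ∧
      shaAn W = ((q * (Nat.card W.toAffine.Point : ℚ) ^ 2 / (W.tamagawaProduct : ℚ) : ℚ) : ℂ) := by
  have hr0 : W.analyticRank = 0 := analyticRank_eq_zero_of_entireLFunction_one_ne_zero W hL
  obtain ⟨hrank, hfin⟩ := hGZK W (by rw [hr0]; exact zero_le_one)
  have hmw0 : W.mordellWeilRank = 0 := by rw [hrank, hr0]
  haveI hE : Finite W.toAffine.Point := W.finite_point_of_rank_zero hmw0
  refine ⟨hmw0, hE, hfin, ?_⟩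
  have hΩ : (W.realPeriodRat : ℂ) ≠ 0 := by exact_mod_cast W.realPeriodRat_pos_holds.ne'
  have hLq : W.entireLFunction 1 = (q : ℂ) * (W.realPeriodRat : ℂ) := by
    rw [← hq, div_mul_cancel₀ _ hΩ]
  rw [shaAn_def, W.leadingLCoeff_eq_of_analyticRank_eq_zero hr0, W.regulator_eq_one_of_rank_zero hmw0,
    W.torsionOrder_eq_natCard_of_finite, hLq]
  push_cast
  field_simp

/-- **`BSD(E,p)` in analytic rank `0` when `p ∤ #Ш(E/ℚ)_an`, from Wuthrich's Prop. 21** (with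
Gross–Zagier–Kolyvagin for `rank E(ℚ) = 0` and the finiteness of `Ш`). Let `E/ℚ` have
`L(E,1) ≠ 0` (globally minimal `W`) and let `p` be an odd prime at which `E` does not have additive
reduction and `ρ̄_{E,p}` is reducible or surjective. If `#Ш(E/ℚ)_an` (`shaAn W`, Miller 2011 §1) is a
rational number of `p`-adic valuation `0`, then Miller's `BSD(E,p)` holds (`BSDp W p`):
`0 ≤ ord_p #Ш ≤ ord_p #Ш_an = 0`. [cite: Wuthrich2014, Prop. 21 (p. 400)]
[cite: Miller2011LMS, Def. 1.1 (arXiv:1010.2431 p. 3)] -/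
theorem bsdp_of_L_one_ne_zero_of_padicValRat_shaAn_eq_zero (hW : sha_dvd_analyticSha)
    (hGZK : rank_eq_analyticRank_of_analyticRank_le_one)
    (W : WeierstrassCurve ℚ) [W.IsElliptic] [W.IsGloballyMinimal] (p : ℕ) [Fact p.Prime]
    (hp : p ≠ 2) (hL : W.entireLFunction 1 ≠ 0)
    (hadd : ¬ ((W.baseChange ℚ_[p]).minimal ℤ_[p]).HasAdditiveReduction ℤ_[p])
    (himg : ¬ W.HasIrreducibleModPGaloisRep p ∨ W.HasSurjectiveModNGaloisRep p)
    (hunit : ∃ q : ℚ, shaAn W = (q : ℂ) ∧ padicValRat p q = 0) :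
    BSDp W p := by
  have hr0 : W.analyticRank = 0 := analyticRank_eq_zero_of_entireLFunction_one_ne_zero W hL
  obtain ⟨hrank, hfin⟩ := hGZK W (by rw [hr0]; exact zero_le_one)
  have hmw0 : W.mordellWeilRank = 0 := by rw [hrank, hr0]
  haveI hE : Finite W.toAffine.Point := W.finite_point_of_rank_zero hmw0
  haveI := hfin
  obtain ⟨q, hq, hq0, hle⟩ := padicValNat_shaOrder_le_of_sha_dvd hW W p hp hL hE hfin hadd himg
  obtain ⟨-, -, -, hshaAn⟩ := shaAn_eq_of_L_one_div_eq hGZK W hL hq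
  obtain ⟨q', hq', hv'⟩ := hunit
  have hqq : q' = q * (Nat.card W.toAffine.Point : ℚ) ^ 2 / (W.tamagawaProduct : ℚ) := by
    exact_mod_cast hq'.symm.trans hshaAn
  rw [hqq] at hv'
  have hsha0 : padicValNat p W.shaOrder = 0 := by
    have h : (padicValNat p W.shaOrder : ℤ) ≤ 0 := hv' ▸ hle
    omega
  refine ⟨hrank, Finite.of_injective _ Subtype.val_injective, _, hshaAn, ?_⟩
  rw [hv', padicValNat_card_addPrimaryComponent]
  change (0 : ℤ) = (padicValNat p W.shaOrder : ℤ)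
  rw [hsha0, Nat.cast_zero]


/-- `#Ш_an · (#Ш · Reg · Ω · ∏ c_ℓ / #E(ℚ)_tors²) = (L^{(r)}(E,1)/r!) · #Ш`: Miller's analytic order of
`Ш` times the BSD right-hand side is the leading coefficient times `#Ш` (all other factors cancel;
`Ω, Reg, #E(ℚ)_tors, ∏ c_ℓ` are nonzero). [cite: Miller2011LMS, §1 (arXiv:1010.2431 p. 3)] -/
theorem shaAn_mul_bsdRHS (W : WeierstrassCurve ℚ) [W.IsElliptic] :
    shaAn W * (W.bsdRHS : ℂ) = W.leadingLCoeff * (W.shaOrder : ℂ) := by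
  have hΩ : (W.realPeriodRat : ℂ) ≠ 0 := by exact_mod_cast W.realPeriodRat_pos_holds.ne'
  have hR : (W.regulator : ℂ) ≠ 0 := by exact_mod_cast (W.regulator_pos').ne'
  have ht : (W.torsionOrder : ℂ) ≠ 0 := by exact_mod_cast W.torsionOrder_pos_holds.ne'
  have hcp : (W.tamagawaProduct : ℂ) ≠ 0 := by
    exact_mod_cast (W.tamagawaProduct_pos_holds : 0 < W.tamagawaProduct).ne'
  rw [shaAn_def, W.bsdRHS_def]
  push_cast
  field_simp

/-- **`BSD(E,p)` is an isogeny invariant** (Cassels 1965; Milne, *ADT*, Thm. I.7.3; "`BSD(E,p)` is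
an isogeny invariant", Miller 2011, §1), in the precise form: for `ℚ`-isogenous elliptic curves with
globally minimal models `W ∼ W'`, if `Ш(W'/ℚ)` is finite, `L^{(r)}(W',1)/r! ≠ 0` and `BSD(W',p)`
holds, then `BSD(W,p)` holds. Inputs: the isogeny invariance of the BSD quotient (the named fact
`WeierstrassCurve.bsdRHS_eq_of_isIsogenous`, hypothesis `hCassels`), of the `L`-function
(`leadingLCoeff_eq_of_isIsogenous'`, Faltings/Knapp 11.67, proved), of the rank
(`mordellWeilRank_eq_of_isIsogenous_holds`, proved) and of the finiteness of `Ш` (Cassels' fact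
again); whence `#Ш_an(W) = #Ш_an(W') · #Ш(W)/#Ш(W')` (`shaAn_mul_bsdRHS`).
[cite: MilneADT2006, Thm. I.7.3 and Remark I.7.4] [cite: Miller2011LMS, §1 (arXiv:1010.2431 p. 3)] -/
theorem bsdp_of_isIsogenous (hCassels : bsdRHS_eq_of_isIsogenous)
    {W W' : WeierstrassCurve ℚ} [W.IsElliptic] [W'.IsElliptic] [W.IsGloballyMinimal]
    [W'.IsGloballyMinimal] (hiso : IsIsogenous W W') (hfin' : Finite W'.sha)
    (hlead : W'.leadingLCoeff ≠ 0) {p : ℕ} [Fact p.Prime] (h : BSDp W' p) : BSDp W p := by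
  obtain ⟨hrank', -, q', hq', hv'⟩ := h
  obtain ⟨hfin, hRHS⟩ := hCassels W' W (hiso.symm_of_charZero) hfin'
  haveI : Finite W.sha := hfin
  haveI : Finite W'.sha := hfin'
  have hlead_eq : W.leadingLCoeff = W'.leadingLCoeff := leadingLCoeff_eq_of_isIsogenous' hiso
  have hsha : (W.shaOrder : ℂ) ≠ 0 := by exact_mod_cast (W.shaOrder_pos hfin).ne'
  have hsha' : (W'.shaOrder : ℂ) ≠ 0 := by exact_mod_cast (W'.shaOrder_pos hfin').ne'
  have hshaQ : (W.shaOrder : ℚ) ≠ 0 := by exact_mod_cast (W.shaOrder_pos hfin).ne'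
  have hshaQ' : (W'.shaOrder : ℚ) ≠ 0 := by exact_mod_cast (W'.shaOrder_pos hfin').ne'
  -- `bsdRHS(W) = bsdRHS(W') ≠ 0`
  have hRHS0 : (W'.bsdRHS : ℂ) ≠ 0 := by
    intro h0
    have h1 := shaAn_mul_bsdRHS W'
    rw [h0, mul_zero] at h1
    exact mul_ne_zero hlead hsha' h1.symm
  -- `#Ш_an(W) = #Ш_an(W') · #Ш(W) / #Ш(W')`
  have hkey : shaAn W = shaAn W' * (W.shaOrder : ℂ) / (W'.shaOrder : ℂ) := by
    have h1 := shaAn_mul_bsdRHS W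
    have h2 := shaAn_mul_bsdRHS W'
    rw [hRHS, hlead_eq] at h1
    rw [eq_div_iff hsha']
    have h3 : shaAn W * (W'.bsdRHS : ℂ) * (W'.shaOrder : ℂ) =
        shaAn W' * (W.shaOrder : ℂ) * (W'.bsdRHS : ℂ) := by
      calc shaAn W * (W'.bsdRHS : ℂ) * (W'.shaOrder : ℂ)
          = W'.leadingLCoeff * (W.shaOrder : ℂ) * (W'.shaOrder : ℂ) := by rw [h1]
        _ = (shaAn W' * (W'.bsdRHS : ℂ)) * (W.shaOrder : ℂ) := by rw [h2]; ring
        _ = shaAn W' * (W.shaOrder : ℂ) * (W'.bsdRHS : ℂ) := by ring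
    have h4 : (shaAn W * (W'.shaOrder : ℂ)) * (W'.bsdRHS : ℂ) =
        (shaAn W' * (W.shaOrder : ℂ)) * (W'.bsdRHS : ℂ) := by
      rw [← h3]; ring
    exact mul_right_cancel₀ hRHS0 h4
  have hq0 : q' ≠ 0 := by
    rintro rfl
    have h2 := shaAn_mul_bsdRHS W'
    rw [hq', Rat.cast_zero, zero_mul] at h2
    exact mul_ne_zero hlead hsha' h2.symm
  refine ⟨?_, Finite.of_injective _ Subtype.val_injective,
    q' * (W.shaOrder : ℚ) / (W'.shaOrder : ℚ), ?_, ?_⟩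
  · rw [mordellWeilRank_eq_of_isIsogenous_holds hiso, analyticRank_eq_of_isIsogenous' hiso, hrank']
  · rw [hkey, hq']
    push_cast
    rfl
  · rw [padicValRat.div (mul_ne_zero hq0 hshaQ) hshaQ', padicValRat.mul hq0 hshaQ, hv',
      padicValNat_card_addPrimaryComponent, padicValNat_card_addPrimaryComponent,
      padicValRat.of_nat, padicValRat.of_nat]
    change (padicValNat p W'.shaOrder : ℤ) + (padicValNat p W.shaOrder : ℤ) -
        (padicValNat p W'.shaOrder : ℤ) = (padicValNat p W.shaOrder : ℤ)
    ring


end Literature.NumberTheory.EllipticCurves.Wuthrich2014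

end
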